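import Literature.NumberTheory.LocalFields.PadicMultiplicativeRepresentatives
import Literature.NumberTheory.EllipticCurves.Kato2004.SemilocalDecompositionProofs
import Mathlib.NumberTheory.Padics.PadicNumbers
import HarnessLib

/-!
# Cell abc-stewartyu, WP-Y3 (x): the odd-order Teichmüller twist at `p ≡ 3 (mod 4)`

`Summits/ABC/StewartYu/PadicTwistExists.lean` — cell `abc-stewartyu` (seat p2; cruxes
`W80ThreeModFour` / `FinBoundThreeModFour`, fallback stmt-ABC-19249).  Theorems only; no named fact.

For an odd prime `p` with `p ≡ 3 (mod 4)` the number `G = (p−1)/2` is ODD, and every rational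
`p`-adic unit `a` becomes, after a sign `σ = ±1`, a principal unit times a root of unity `η ∈ ℚ_p` of
order dividing `G`: `η^G = 1`, `‖σ a η − 1‖ ≤ p⁻¹` (`twist_exists_threeModFour`).  Proof: lit's
Teichmüller layer gives a primitive `(p−1)`-th root `ζ ∈ ℤ_p` (Kato2004
`padicInt_exists_isPrimitiveRoot_sub_one`) and `r'` with `‖a ζ^{r'} − 1‖ < 1`
(`padicInt_exists_norm_mul_pow_sub_one_lt`); `ζ^G = −1`, so `η := ζ^{r'}` has `η^G = (−1)^{r'}`;
if `r'` is odd replace `(a, η)` by `(−a, −η)` (`(−η)^G = (−1)^{G + r'} = 1`, `(−a)(−η) = aη`).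
This is the input `η` of `TwistSetup` (`PadicTwistSetup.lean`) in the design HOME/p2/memo-04 §4.

## References
* [Yu1990] K. Yu, *Linear forms in p-adic logarithms II*, Compositio Math. 74 (1990), (2.19)–(2.24).
* [Serre1973] J.-P. Serre, *A Course in Arithmetic*, Ch. II §3.1.
-/

noncomputable section

open Literature.NumberTheory.LocalFields
open Literature.NumberTheory.EllipticCurves.Kato2004 (padicInt_exists_isPrimitiveRoot_sub_one)

namespace Summit.ABC.StewartYu

namespace TwistSetup

variable {p : ℕ} [Fact p.Prime]

omit [Fact p.Prime] in
/-- `(p − 1)/2` is odd when `p ≡ 3 (mod 4)`. [folklore] -/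
theorem odd_half_sub_one (hp4 : p % 4 = 3) : Odd ((p - 1) / 2) :=
  ⟨(p - 3) / 4, by omega⟩

/-- A primitive `(p−1)`-th root of unity `ζ` of `ℤ_p` (`p` odd) has `ζ^{(p−1)/2} = −1`. [folklore] -/
theorem pow_half_eq_neg_one (hp3 : 3 ≤ p) {ζ : ℤ_[p]} (hζ : IsPrimitiveRoot ζ (p - 1)) :
    ζ ^ ((p - 1) / 2) = -1 := by
  have hp : p.Prime := Fact.out
  have hodd : Odd p := hp.odd_of_ne_two (by omega)
  have h2 : 2 * ((p - 1) / 2) = p - 1 := by obtain ⟨k, hk⟩ := hodd; omega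
  have hsq : (ζ ^ ((p - 1) / 2)) ^ 2 = 1 := by
    rw [← pow_mul, mul_comm, h2, hζ.pow_eq_one]
  have hne : ζ ^ ((p - 1) / 2) ≠ 1 := by
    intro h
    have hdvd := hζ.dvd_of_pow_eq_one _ h
    have hpos : 0 < (p - 1) / 2 := by omega
    exact absurd (Nat.le_of_dvd hpos hdvd) (by omega)
  rcases sq_eq_one_iff.mp hsq with h | h
  · exact absurd h hne
  · exact h

/-- In `ℚ_p`, `‖x − 1‖ < 1` for `x` of norm `≤ 1` forces `‖x − 1‖ ≤ p⁻¹` (the value group is `p^ℤ`).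
[folklore] -/
theorem norm_sub_one_le_inv_of_lt {x : ℚ_[p]} (hx : ‖x - 1‖ < 1) : ‖x - 1‖ ≤ (p : ℝ)⁻¹ := by
  have hp : p.Prime := Fact.out
  have hp1 : (1 : ℝ) < p := by exact_mod_cast hp.one_lt
  by_cases h0 : x - 1 = 0
  · rw [h0, norm_zero]; positivity
  · rw [Padic.norm_eq_zpow_neg_valuation h0] at hx ⊢
    have hv : 0 < (x - 1).valuation := by
      by_contra hle
      push Not at hle
      have : (1 : ℝ) ≤ (p : ℝ) ^ (-(x - 1).valuation) := one_le_zpow₀ hp1.le (by omega)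
      linarith
    rw [← zpow_neg_one]
    exact zpow_le_zpow_right₀ hp1.le (by omega)

/-- **The odd-order twist at `p ≡ 3 (mod 4)`**: for a rational `p`-adic unit `a` there are a sign
`σ = ±1` and `η ∈ ℚ_p` with `η^{(p−1)/2} = 1` and `‖σ a · η − 1‖ ≤ p⁻¹`.
[cite: Yu1990, (2.19)–(2.24)] [cite: Serre1973, Ch. II §3.1 Prop. 7] -/
theorem twist_exists_threeModFour (hp4 : p % 4 = 3) {a : ℚ} (ha : a ≠ 0)
    (hva : padicValRat p a = 0) :
    ∃ (σ : ℤ) (η : ℚ_[p]), (σ = 1 ∨ σ = -1) ∧ η ^ ((p - 1) / 2) = 1 ∧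
      ‖(((σ : ℚ) * a : ℚ) : ℚ_[p]) * η - 1‖ ≤ (p : ℝ)⁻¹ := by
  have hp : p.Prime := Fact.out
  have hp3 : 3 ≤ p := by have := hp.two_le; omega
  -- `a` as a unit of `ℤ_p`
  have hna : ‖(a : ℚ_[p])‖ = 1 := by
    rw [Padic.norm_eq_zpow_neg_valuation (by exact_mod_cast ha), Padic.valuation_ratCast, hva]
    simp
  set A : ℤ_[p] := ⟨(a : ℚ_[p]), hna.le⟩ with hA
  have hAn : ‖A‖ = 1 := hna
  obtain ⟨ζ, hζ⟩ := padicInt_exists_isPrimitiveRoot_sub_one (p := p)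
  obtain ⟨r, -, hr⟩ := padicInt_exists_norm_mul_pow_sub_one_lt hζ hAn
  have hζG : ζ ^ ((p - 1) / 2) = -1 := pow_half_eq_neg_one hp3 hζ
  have hG : Odd ((p - 1) / 2) := odd_half_sub_one hp4
  -- the two cases on the parity of `r`
  rcases Nat.even_or_odd r with hre | hro
  · refine ⟨1, ((ζ : ℚ_[p])) ^ r, Or.inl rfl, ?_, ?_⟩
    · rw [← pow_mul, mul_comm, pow_mul]
      have : ((ζ : ℚ_[p])) ^ ((p - 1) / 2) = -1 := by exact_mod_cast congrArg ((↑) : ℤ_[p] → ℚ_[p]) hζG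
      rw [this, hre.neg_one_pow]
    · apply norm_sub_one_le_inv_of_lt
      have : (((1 : ℤ) : ℚ) * a : ℚ) = a := by simp
      rw [this]
      have e : (a : ℚ_[p]) * (ζ : ℚ_[p]) ^ r - 1 = ((A * ζ ^ r - 1 : ℤ_[p]) : ℚ_[p]) := by
        rw [hA]; push_cast; ring
      rw [e]; exact hr
  · refine ⟨-1, -((ζ : ℚ_[p])) ^ r, Or.inr rfl, ?_, ?_⟩
    · rw [neg_pow, ← pow_mul, mul_comm (r), pow_mul]
      have : ((ζ : ℚ_[p])) ^ ((p - 1) / 2) = -1 := by exact_mod_cast congrArg ((↑) : ℤ_[p] → ℚ_[p]) hζG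
      rw [this, hro.neg_one_pow, hG.neg_one_pow]; norm_num
    · apply norm_sub_one_le_inv_of_lt
      have e : ((((-1 : ℤ) : ℚ) * a : ℚ) : ℚ_[p]) * -(ζ : ℚ_[p]) ^ r - 1 =
          ((A * ζ ^ r - 1 : ℤ_[p]) : ℚ_[p]) := by
        rw [hA]; push_cast; ring
      rw [e]; exact hr

/-- The twist for a whole family of units, as functions (choice). [cite: Yu1990, (2.19)–(2.24)] -/
theorem twist_exists_family (hp4 : p % 4 = 3) {n : ℕ} (a : Fin n → ℚ)
    (ha : ∀ i, a i ≠ 0 ∧ padicValRat p (a i) = 0) :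
    ∃ (σ : Fin n → ℤ) (η : Fin n → ℚ_[p]), (∀ i, σ i = 1 ∨ σ i = -1) ∧
      (∀ i, η i ^ ((p - 1) / 2) = 1) ∧
      ∀ i, ‖(((σ i : ℚ) * a i : ℚ) : ℚ_[p]) * η i - 1‖ ≤ (p : ℝ)⁻¹ := by
  choose σ η hσ hη hprin using fun i => twist_exists_threeModFour hp4 (ha i).1 (ha i).2
  exact ⟨σ, η, hσ, hη, hprin⟩

end TwistSetup

end Summit.ABC.StewartYu

end
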